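import Summits.BirchSwinnertonDyer.Rank1Residual.Supersingular.KuriharaTwistSymbolKurihara
import Summits.BirchSwinnertonDyer.Rank1Residual.Supersingular.KuriharaTwistRecordOmega
import HarnessLib

/-!
# Twist records: the WORKED SAMPLE — every record-side hypothesis of
# `TwistRecord.kuriharaNumber_ne_zero_of_consistent` discharged in the kernel on the schema sample
# (`43314b1` @ `5`, `n = 10291 = 41·251`), leaving exactly the curve-side binders and `hbins`

Cell `b2b-bsdres`, supersingular family, prover A = unit `b2b-bsdres-x10b` (gen 10).  Topic file; namespace
`Summit.BirchSwinnertonDyer.Rank1Residual.Supersingular.KuriharaTwist`.  THEOREMS ONLY; nothing asserted about any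
curve (the cusp form `f` and its Hecke / integrality data stay hypotheses); nothing booked.

HONEST FRAMING (run/shared/lean/b2b/bsd-rank1-residual/, verbatim in every file): the goal of the
cell is to DELETE the COMBINATION-SHAPED residual classes of the Birch–Swinnerton-Dyer formula for
ALL analytic-rank `≤ 1` elliptic curves over `ℚ` — "full BSD formula for every rank `≤ 1` curve in
class `C`" assembled STRICTLY from published theorems — so that the rank-`≤ 1` remainder becomes
exactly the CONSTRUCTION-SHAPED classes, which are TYPED (missing-input `Prop`s), NOT attempted.
This is not "finishing BSD".

## What this file shows

`sampleRecord` is the record of `KuriharaTwistSchema.certifiedL_sample` (the level carrying all three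
implementations).  `kuriharaNumber_ne_zero_sample`: for ANY cusp form `f` with the Hecke relation
(`A_41 ≡ A_251 ≡ 2 (mod 5)`) and `5`-integrality at the level, and ANY discrete logarithms `ψ`, the
identification `hbins` ALONE gives `kuriharaNumber f (5^1) 10291 ψ ≠ 0` — the record-side hypotheses
(`consistent` by `decide`, `0 < deltaModP`, `#primes < p`, `ω(10291) = 2` via `KuriharaTwistRecordOmega` and
`norm_num` primality of `41`, `251`, `NeZero`, `Fact (Nat.Prime 5)`) are all discharged here, which is the
template for every landed `certL_…` row.  No definition is introduced except the abbreviation of the sample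
record (a `def` of a literal, for readability).
-/

namespace Summit.BirchSwinnertonDyer.Rank1Residual.Supersingular.KuriharaTwist

open Literature.NumberTheory.DiophantineGeometry.Dioph (ratModP)
open Literature.NumberTheory.EllipticCurves Literature.NumberTheory.EllipticCurves.ModularForms
open CongruenceSubgroup Finset
open scoped MatrixGroups ModularForm

/-- The schema sample record (`KuriharaTwistSchema.certifiedL_sample`): `43314b1` @ `5`, `n = 10291 = 41·251`,
`η = (6, 6)`, `c_∞ = 2`, `D = 1`, bins `(2134, −2968, 2134, −650, −650)`, `δ̃ ≡ 2 (mod 5)`. [cite: Kim2022StructureSelmer, §1.4.3 (PDF p. 7)] -/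
def sampleRecord : TwistRecord :=
  { label := "43314b1", ainvs := [1, 1, 0, -2916550, -1916874476], conductor := 43314, p := 5, n := 10291,
    primes := [41, 251], roots := [6, 6], components := 2, rank := 0, reduction := "good-supersingular",
    den := 1, bins := [2134, -2968, 2134, -650, -650], deltaModP := 2,
    evidence := ["impl1 j102415 = impl2 j102669 = impl3 j107960 (bins exact match)"] }

/-- The sample passes the schema recheck (kernel `decide`, as in `certifiedL_sample`). [folklore] -/
theorem sampleRecord_consistent : sampleRecord.consistent = true := by decide

/-- `p = 5` is prime (instance for the sample). [folklore] -/
instance fact_prime_sample_p : Fact sampleRecord.p.Prime := ⟨by norm_num [sampleRecord]⟩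

/-- `n = 10291 ≠ 0` (instance for the sample). [folklore] -/
instance neZero_sample_n : NeZero sampleRecord.n := ⟨by decide⟩

/-- The listed level primes `41`, `251` are prime (`norm_num`). [folklore] -/
theorem sampleRecord_primes_prime : ∀ ℓ ∈ sampleRecord.primes, ℓ.Prime := by
  intro ℓ hℓ
  simp only [sampleRecord, List.mem_cons, List.mem_nil_iff, or_false] at hℓ
  rcases hℓ with rfl | rfl <;> norm_num

/-- `ω(10291) = 2 = #primes`, from the recheck and the primality of the listed primes
(`TwistRecord.card_primeFactors_eq_of_consistent`). [folklore] -/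
theorem sampleRecord_card_primeFactors : sampleRecord.n.primeFactors.card = sampleRecord.primes.length :=
  sampleRecord.card_primeFactors_eq_of_consistent sampleRecord_consistent sampleRecord_primes_prime

/-- `n = 10291` is square-free (two distinct primes; from `ω(n) = 2` bookkeeping: here directly by the
`Nat.squarefree_iff_nodup_primeFactorsList`-free route `Nat.squarefree_mul` on `41·251`). [folklore] -/
theorem sampleRecord_squarefree : Squarefree sampleRecord.n := by
  have h : sampleRecord.n = 41 * 251 := by decide
  rw [h, Nat.squarefree_mul (by norm_num)]
  exact ⟨(by norm_num : Nat.Prime 41).squarefree, (by norm_num : Nat.Prime 251).squarefree⟩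

variable {N : ℕ} [NeZero N] (f : CuspForm (Gamma0 N) 2)

/-- **THE WORKED SAMPLE.**  For any cusp form `f ∈ S₂(Γ₀(N))` whose plus symbol satisfies the Hecke relation at
`41` and `251` with integer eigenvalues `≡ 2 (mod 5)` and is `5`-integral at every `z/d`, `d ∣ 10291`, and any
discrete logarithms `ψ_ℓ : (ℤ/ℓ)ˣ → ℤ/5`: IF the sample's bins `(2134, −2968, 2134, −650, −650)` are
`1·2·Σ_{a : m(a) = j} [a/10291]⁺_f` (`hbins`), THEN `kuriharaNumber f (5^1) 10291 ψ ≠ 0`.  Every record-side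
hypothesis is discharged in the kernel; what remains is curve/engine-side. [cite: Kim2022StructureSelmer, §1.4.3 (PDF p. 7)] -/
theorem kuriharaNumber_ne_zero_sample (A : ℕ → ℤ)
    (hhecke : ∀ ℓ ∈ sampleRecord.n.primeFactors, ∀ x : ℚ, (A ℓ : ℚ) * ratPlusSymbol f x =
      ∑ j : Fin ℓ, ratPlusSymbol f ((x + ((j : ℕ) : ℚ)) / (ℓ : ℚ)) + ratPlusSymbol f ((ℓ : ℚ) * x))
    (hA : ∀ ℓ ∈ sampleRecord.n.primeFactors, ((A ℓ : ℤ) : ZMod (sampleRecord.p ^ 1)) = 2)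
    (hint : ∀ d : ℕ, d ∣ sampleRecord.n → ∀ z : ℤ,
      ‖((ratPlusSymbol f ((z : ℚ) / (d : ℚ)) : ℚ) : ℚ_[sampleRecord.p])‖ ≤ 1)
    (ψ : (ℓ : ℕ) → (ZMod ℓ)ˣ →* Multiplicative (ZMod (sampleRecord.p ^ 1)))
    (hbins : ∀ j < sampleRecord.p, ((sampleRecord.bins.getD j 0 : ℤ) : ℚ) =
      (sampleRecord.den : ℚ) * (sampleRecord.components : ℚ) *
      ∑ a ∈ (Finset.univ : Finset (ZMod sampleRecord.n)ˣ).filter (fun a =>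
        (∑ ℓ ∈ sampleRecord.n.primeFactors.attach, Multiplicative.toAdd
          (ψ ℓ.1 (ZMod.unitsMap (Nat.dvd_of_mem_primeFactors ℓ.2) a))).val = j),
        ratPlusSymbol f ((((a : ZMod sampleRecord.n).val : ℕ) : ℚ) / (sampleRecord.n : ℚ))) :
    kuriharaNumber f (sampleRecord.p ^ 1) sampleRecord.n ψ ≠ 0 :=
  sampleRecord.kuriharaNumber_ne_zero_of_consistent f sampleRecord_consistent (by decide) (by decide)
    sampleRecord_squarefree sampleRecord_card_primeFactors A hhecke hA hint ψ hbins

end Summit.BirchSwinnertonDyer.Rank1Residual.Supersingular.KuriharaTwist
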